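import Summits.BirchSwinnertonDyer.BirchSwinnertonDyer.Theorems.EdixhovenFibreFiveSevenTwistDegreeStepFiveSevenKPTors
import Summits.BirchSwinnertonDyer.BirchSwinnertonDyer.Theorems.EdixhovenFibreFiveSevenTwistDegreeStepFiveSevenLTwistCore
import Summits.BirchSwinnertonDyer.BirchSwinnertonDyer.Theorems.EdixhovenFibreFiveSevenPeriodTwistNonEisenstein
import Summits.BirchSwinnertonDyer.BirchSwinnertonDyer.Theorems.EdixhovenFibreFiveSevenPeriodTwistNewformTwist
import Summits.BirchSwinnertonDyer.BirchSwinnertonDyer.Theorems.EdixhovenFibreFiveSevenKPResidueOfKatoPeriodTwist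
import Summits.BirchSwinnertonDyer.BirchSwinnertonDyer.Theorems.EdixhovenFibreFiveSevenNonEisensteinWitness
import Literature.NumberTheory.EllipticCurves.ModularCurveIharaLemmaSquare
import Literature.NumberTheory.EllipticCurves.ModularCurveNonempty
import Literature.NumberTheory.EllipticCurves.ModularityVersionApProofs
import HarnessLib

/-!
# Route `EdixhovenFibreFiveSeven`, crux TDS57 (stmt-BirchSwinnertonDyer-22227): L-TWIST ASSEMBLED — the hypothesis
# `hLT` of `twistDegreeStepFiveSeven_of_kato_of_periodTwist` VERBATIM from the three-copy Ihara lemma (cite-only)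
# and a non-Eisenstein witness; TDS57 ⟸ F″ ∧ Ihara³ ∧ witness (`--supports`, helper)

Cell `pub/bsd-wall` (D-0145 line `route-BirchSwinnertonDyer-EdixhovenFibreFiveSeven`), seat `bsd-line-edix-p4`
(prover), part (B) + ASSEMBLY of the three-seat split of (L-TWIST) (bus 2026-08-28T00:27:17Z / 00:41:49Z:
(A) edix-p2 = the double-twist identity and the core `LTwist.lTwist_core`; (B) edix-p4 = the three-copy Ihara
lemma `ModularForms.diamondRibet1997_iharaLemma_sq` (Literature, cite-only, p590882) + this assembly; (C) edix-p3 =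
the non-Eisenstein eigencharacter `PeriodTwistNonEisenstein.exists_eigenChar_not_isEisenstein` and the newform of
the twist `NewformTwist.level_eq_and_periodLattice_newform_twist_eq`; the Chebotarev WITNESS (a prime
`r₀ ≡ 1 (mod S)` with `a_{r₀} ≢ r₀ + 1 (mod p)` from `E[p]` irreducible) = edix-p5, taken here as the
hypothesis `hW`). THEOREMS ONLY (no definition, no named fact, no `sorry`). CONDITIONAL on the cite-only facts
named in the signatures; nothing is closed unconditionally and BSD is not proved by this file.

* §1 `three_lt_of_modularParametrizationData` (a level with a datum is `> 3`: genus-zero levels carry none) and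
  `coeff_laws_of_isNewformOf` (`a₀ = 0`, multiplicativity, good Euler recursion at `q ∤ N` for the newform of an
  elliptic curve — the three coefficient inputs of `lTwist_core`).
* §2 **`lTwist_of_iharaSq_of_witness : diamondRibet1997_iharaLemma_sq → hW → hLT`** (hLT verbatim) and
  **`twistDegreeStepFiveSeven_of_kato_of_iharaSq_of_witness : F″ → diamondRibet1997_iharaLemma_sq → hW →
  TwistDegreeStepFiveSeven`** (one line over p589348).

References: [DiamondRibet1997] §4.5 Lemma 4.6; [DarmonDiamondTaylor1995] §4.5 p. 137, Lemma 4.12 (p. 120);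
[Stevens1989] Lemma (5.4); [DiamondShurman2005] Thm. 3.5.1, (8.44); [Kato2004Asterisque] (8.1.3), Thm. 9.7.
-/
set_option autoImplicit false
-- the Theorems directory repeats the summit name (sibling precedent `SignedBaseChangeAssembly.lean`)
set_option linter.dupNamespace false

noncomputable section

open scoped Classical MatrixGroups NumberTheorySymbols

open WeierstrassCurve NumberField Literature.NumberTheory.EllipticCurves
  Literature.NumberTheory.EllipticCurves.ModularForms
  Literature.NumberTheory.EllipticCurves.Rank1Residual Literature.NumberTheory.QuadraticFields
  Summit.BirchSwinnertonDyer.BirchSwinnertonDyer.Theorems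
  Summit.BirchSwinnertonDyer.BirchSwinnertonDyer.Theses.EdixhovenFibreFiveSeven CongruenceSubgroup

namespace Summit.BirchSwinnertonDyer.BirchSwinnertonDyer.Theorems.LTwist

/-! ### §1 Small inputs: the level exceeds `3`; coefficient laws of the newform of an elliptic curve -/

/-- **A level carrying a modular parametrisation datum is `> 3`** (indeed `≥ 11`): the levels `1, …, 10`
have genus zero and carry no datum (`ModularParametrizationData_isEmpty_of_mem_genusZeroLevels`,
Diamond–Shurman Thm. 3.5.1 / Figure 3.3). Supplies the binder `3 < M` of `diamondRibet1997_iharaLemma_sq`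
at the conductor level of an elliptic curve. [cite: DiamondShurman2005, Thm. 3.5.1 with Figure 3.3] -/
theorem three_lt_of_modularParametrizationData {W : WeierstrassCurve ℚ} {N : ℕ} [NeZero N]
    (D : ModularParametrizationData W N) : 3 < N := by
  by_contra hle
  push Not at hle
  have hpos : 0 < N := Nat.pos_of_ne_zero (NeZero.ne N)
  have key : N ∈ ({1, 2, 3, 4, 5, 6, 7, 8, 9, 10, 12, 13, 16, 18, 25} : Finset ℕ) := by
    interval_cases N <;> decide
  exact (ModularParametrizationData_isEmpty_of_mem_genusZeroLevels W N key).false D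

/-- **Coefficient laws of the newform of an elliptic curve** (the three inputs of `lTwist_core`): for
`f` with `aₙ(f) = aₙ(W)` (`IsNewformOf`) and a prime `q ∤ N(W)`: `a₀ = 0`, `a_{mn} = a_m a_n` for coprime
`m, n` (`isMultiplicative_LFunction`), and the good Euler recursion `a_{q^{e+2}} = a_q a_{q^{e+1}} − q a_{q^e}`
(`LFunction_apply_prime_pow_add_two_of_prime`, Diamond–Shurman (8.44)). [cite: DiamondShurman2005, §8.8 (8.44)] -/
theorem coeff_laws_of_isNewformOf {W : WeierstrassCurve ℚ} [W.IsElliptic] {M : ℕ} [NeZero M]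
    {f : CuspForm (Gamma0 M) 2} (hf : IsNewformOf W f) {q : ℕ} (hq : q.Prime)
    (hqN : ¬ q ∣ W.conductorNorm ℤ) :
    cuspCoeff f 0 = 0 ∧
      (∀ m n : ℕ, m.Coprime n → cuspCoeff f (m * n) = cuspCoeff f m * cuspCoeff f n) ∧
      (∀ e : ℕ, cuspCoeff f (q ^ (e + 2)) =
        cuspCoeff f q * cuspCoeff f (q ^ (e + 1)) - q * cuspCoeff f (q ^ e)) := by
  refine ⟨?_, fun m n hmn ↦ ?_, fun e ↦ ?_⟩
  · rw [hf.2 0, ArithmeticFunction.map_zero, Int.cast_zero]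
  · rw [hf.2, hf.2, hf.2, W.isMultiplicative_LFunction.map_mul_of_coprime hmn, Int.cast_mul]
  · rw [hf.2, hf.2, hf.2, hf.2, W.LFunction_apply_prime_pow_add_two_of_prime hq e, if_neg hqN]
    push_cast
    ring

/-! ### §2 L-TWIST from the three-copy Ihara lemma -/

/-- **L-TWIST (the twisted-period decomposition `Λ(f) ⊆ s·Λ(g) + p·Λ(f)`, `s² = q*`) — hypothesis `hLT`
of `TwistDegreeStepFiveSevenKPTors.twistDegreeStepFiveSeven_of_kato_of_periodTwist` VERBATIM — GRANTED the
three-copy Ihara lemma `diamondRibet1997_iharaLemma_sq` (Diamond–Ribet 1997 Lemma 4.6, `m_p = 2`;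
Darmon–Diamond–Taylor 1995 §4.5 p. 137, cite-only) and a non-Eisenstein WITNESS `hW` (for `E[p]`
irreducible: a prime `r₀ ≡ 1 (mod S)`, `r₀ ∤ S`, with `a_{r₀}(E) ≢ r₀ + 1 (mod p)`; Chebotarev + «all traces
`2` on `G_{ℚ(ζ_S)}` ⇒ reducible», Darmon–Diamond–Taylor Lemma 4.12 direction ⟸ — being PROVED by seat
edix-p5 from the tree's `chebotarev_geomTorsion`; taken as a hypothesis here so that this theorem is
unconditional on it).** ASSEMBLY of the three-seat split (bus 2026-08-28T00:27:17Z): for `V₀` (conductor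
`M`, datum `D₀`, `f = D₀.f`), an odd prime `q ≠ p` with `q ∤ M`, a minimal model `Vχ` of `V₀ ⊗ χ_{q*}` and a
newform `g` of `Vχ` at any level: (C-ii) `g`'s period lattice is that of `f_χ = charTwist (M q²) … f`
(`NewformTwist.level_eq_and_periodLattice_newform_twist_eq`, edix-p3); (C-i) the reduced eigencharacter
`χ̄ : 𝕋̃ = ℤ[T_r : r ∤ Mq²] → 𝔽_p` of `f` has maximal, odd, non-Eisenstein kernel `𝔫`
(`PeriodTwistNonEisenstein.exists_eigenChar_not_isEisenstein`, edix-p3, fed the witness); (B) the fact at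
`𝔫` (`3 < M` by `three_lt_of_modularParametrizationData`, `q ∉ 𝔫` as `p ≠ q`) gives `s ∉ 𝔫` and the
`(x, 0, 0)`-lift of every cycle, with `s f = u f`, `p ∤ u`; (A) `LTwist.lTwist_core` (edix-p2: the double
twist `(f_χ)_χ = B₁f − (a_q/q)B_q f + (1/q)B_{q²}f`, Stevens (5.4) on `Γ₀`, `τ(χ)² = q*`, Bezout) concludes.
CONDITIONAL on the cite-only fact `hI`; BSD is not proved by this.
[cite: DiamondRibet1997, §4.5 Lemma 4.6 (p. 371), case m_p = 2]
[cite: DarmonDiamondTaylor1995, §4.5 p. 137 and Lemma 4.12 (p. 120)]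
[cite: Stevens1989, Lemma (5.4) p. 97] -/
theorem lTwist_of_iharaSq_of_witness (hI : diamondRibet1997_iharaLemma_sq)
    (hW : ∀ (W : WeierstrassCurve ℚ) [W.IsElliptic] [W.IsGloballyMinimal] (p : ℕ) [Fact p.Prime] (S : ℕ),
      p ≠ 2 → Irr W p → S ≠ 0 →
      ∃ r₀ : ℕ, r₀.Prime ∧ ¬ r₀ ∣ S ∧ r₀ ≡ 1 [MOD S] ∧ ¬ (p : ℤ) ∣ W.LFunction r₀ - (r₀ + 1)) :
    ∀ (p : ℕ) [Fact p.Prime] (q : ℕ) [Fact q.Prime] (V₀ : WeierstrassCurve ℚ) [V₀.IsElliptic]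
      [V₀.IsGloballyMinimal] [NeZero (V₀.conductorNorm ℤ)]
      (D₀ : ModularParametrizationData V₀ (V₀.conductorNorm ℤ)), 5 ≤ p → Irr V₀ p → q ≠ 2 → q ≠ p →
      ¬ q ∣ V₀.conductorNorm ℤ →
      ∀ (Vχ : WeierstrassCurve ℚ) [Vχ.IsElliptic] [Vχ.IsGloballyMinimal] (v : VariableChange ℚ),
      v • V₀.quadraticTwist (((-1 : ℤ) ^ (q / 2) * q : ℤ) : ℚ) = Vχ →
      ∀ (s : ℂ), s ^ 2 = (((-1 : ℤ) ^ (q / 2) * q : ℤ) : ℂ) →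
      ∀ (N' : ℕ) [NeZero N'] (g : CuspForm (Gamma0 N') 2), IsNewformOf Vχ g →
      ∀ z ∈ periodLattice D₀.f, ∃ w ∈ periodLattice g, ∃ y ∈ periodLattice D₀.f,
        z = s * w + (p : ℂ) * y := by
  intro p _ q _ V₀ _ _ _ D₀ hp5 hirr hq2 hqp hqN Vχ _ _ v hv s hs2 N' _ g hg z hz
  have hpP : p.Prime := Fact.out
  have hqP : q.Prime := Fact.out
  haveI : NeZero q := ⟨hqP.ne_zero⟩
  have hp2 : p ≠ 2 := by omega
  set M : ℕ := V₀.conductorNorm ℤ with hM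
  set f : CuspForm (Gamma0 M) 2 := D₀.f with hf_def
  have hf : IsNewformOf V₀ f := D₀.isNewformOf
  have hM3 : 3 < M := three_lt_of_modularParametrizationData D₀
  -- (C-ii): the period lattice of `g` is that of `f_χ`, `χ = jacobiChar q` the Legendre character
  have hχq : (jacobiChar q).IsQuadratic := isQuadratic_jacobiChar
  have hprim : (jacobiChar q).IsPrimitive := isPrimitive_jacobiChar (hqP.odd_of_ne_two hq2) hqP.squarefree
  have hχJ : ∀ a : ℤ, jacobiChar q a = (J(a | q) : ℂ) := fun a ↦ jacobiChar_intCast a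
  obtain ⟨-, hΛg⟩ := NewformTwist.level_eq_and_periodLattice_newform_twist_eq V₀ hqP hq2 hqN Vχ v hv hf hqN
    hχq hprim hχJ g hg
  -- the non-Eisenstein witness and (C-i): the reduced eigencharacter `χ̄ : 𝕋̃ → 𝔽_p`
  have hS : M * q ^ 2 ≠ 0 := mul_ne_zero (NeZero.ne M) (pow_ne_zero 2 hqP.ne_zero)
  obtain ⟨r₀, hr₀, hr₀S, hr₀1, hE₀⟩ := hW V₀ p (M * q ^ 2) hp2 hirr hS
  obtain ⟨lam, χbar, hlam, -, hχlam, -, hmax, h2, -, -, hE⟩ :=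
    PeriodTwistNonEisenstein.exists_eigenChar_not_isEisenstein (M * q ^ 2) V₀ hf p hp2 hr₀ hr₀S hr₀1 hE₀
  -- (B): the three-copy Ihara lemma at `𝔫 = ker χ̄`
  have hqker : (q : HeckeRing0.primeTo M 2 (M * q ^ 2)) ∉ RingHom.ker χbar := by
    rw [RingHom.mem_ker, map_natCast, ZMod.natCast_eq_zero_iff]
    exact fun h ↦ hqp ((Nat.prime_dvd_prime_iff_eq hpP hqP).mp h).symm
  obtain ⟨s₁, hs₁, hsur⟩ := hI M q hqN hM3 (RingHom.ker χbar) hmax h2 hqker hE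
  -- `s₁ f = u f` with `p ∤ u`
  set u : ℤ := lam (s₁ : HeckeRing0 M 2) with hu_def
  have hu : ¬ (p : ℤ) ∣ u := by
    intro hdvd
    apply hs₁
    rw [RingHom.mem_ker, hχlam, ← hu_def]
    exact (ZMod.intCast_zmod_eq_zero_iff_dvd u p).mpr hdvd
  have hs₀ : HeckeRing0.toEnd M 2 (s₁ : HeckeRing0 M 2) f = (u : ℂ) • f := hlam _
  -- the `(x, 0, 0)`-lift
  have hlift : ∀ x ∈ periodHomology M, ∃ z ∈ periodHomology (M * q ^ 2),
      (degeneracyMap0 M (M * q ^ 2) 1 2).dualMap z = (s₁ : HeckeRing0 M 2) • x ∧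
      (degeneracyMap0 M (M * q ^ 2) q 2).dualMap z = 0 ∧
      (degeneracyMap0 M (M * q ^ 2) (q ^ 2) 2).dualMap z = 0 := by
    intro x hx
    obtain ⟨z, hz, hα, hβ, hγ⟩ := hsur x hx 0 (zero_mem _) 0 (zero_mem _)
    exact ⟨z, hz, hα, by rw [hβ, smul_zero], by rw [hγ, smul_zero]⟩
  -- (A): the core
  obtain ⟨h0, hmul, hrec⟩ := coeff_laws_of_isNewformOf hf hqP hqN
  obtain ⟨w, hw, y, hy, hzwy⟩ := lTwist_core hq2 hqp hχq f h0 hmul hrec (s₁ : HeckeRing0 M 2) u hu hs₀ hlift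
    s hs2 z hz
  exact ⟨w, hΛg ▸ hw, y, hy, hzwy⟩

/-- **TDS57 `TwistDegreeStepFiveSeven` (stmt-BirchSwinnertonDyer-22227) GRANTED F″, the three-copy Ihara lemma
and the non-Eisenstein witness**: `twistDegreeStepFiveSeven_of_kato_of_periodTwist` (edix-p2, p589348) with its
input L-TWIST supplied by `lTwist_of_iharaSq_of_witness`. CONDITIONAL on the two cite-only facts `hF`
(Kato 2004 + Kim–Nakamura, p576988) and `hI` (Diamond–Ribet 1997 Lemma 4.6); `hW` is being proved in the
tree (edix-p5). BSD is not proved by this. [cite: DiamondRibet1997, §4.5 Lemma 4.6 (p. 371)]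
[cite: Kato2004Asterisque, (8.1.3) (p. 180), Thm. 9.7 (p. 189)] -/
theorem twistDegreeStepFiveSeven_of_kato_of_iharaSq_of_witness
    (hF : kato_neron_isIntegral_twistedSymbolSum_of_additive_five_le)
    (hI : diamondRibet1997_iharaLemma_sq)
    (hW : ∀ (W : WeierstrassCurve ℚ) [W.IsElliptic] [W.IsGloballyMinimal] (p : ℕ) [Fact p.Prime] (S : ℕ),
      p ≠ 2 → Irr W p → S ≠ 0 →
      ∃ r₀ : ℕ, r₀.Prime ∧ ¬ r₀ ∣ S ∧ r₀ ≡ 1 [MOD S] ∧ ¬ (p : ℤ) ∣ W.LFunction r₀ - (r₀ + 1)) :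
    TwistDegreeStepFiveSeven :=
  TwistDegreeStepFiveSevenKPTors.twistDegreeStepFiveSeven_of_kato_of_periodTwist hF
    (fun p _ q _ V₀ _ _ _ D₀ hp5 hirr hq2 hqp hqN Vχ _ _ v hv s hs2 N' _ g hg ↦
      lTwist_of_iharaSq_of_witness hI hW p q V₀ D₀ hp5 hirr hq2 hqp hqN Vχ v hv s hs2 N' g hg)

/-! ### §3 (appended) KP57 from F″, the three-copy Ihara lemma and the witness -/

/-- **KP57 `KPResidueManinUnitFiveSeven` (stmt-BirchSwinnertonDyer-23810) GRANTED modularity `exists_isNewformOf`,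
F″, the three-copy Ihara lemma and the non-Eisenstein witness**: edix-p5's
`KPResidueOfKatoPeriodTwist.kpResidueManinUnitFiveSeven_of_kato_of_periodTwist : hnf → F″ → hLT → KP57` with its
input L-TWIST supplied by `lTwist_of_iharaSq_of_witness`. CONDITIONAL on the cite-only facts `hF`, `hI` (and
modularity `hnf`); `hW` is being proved in the tree (edix-p5). BSD is not proved by this.
[cite: DiamondRibet1997, §4.5 Lemma 4.6 (p. 371)] [cite: Kato2004Asterisque, (8.1.3) (p. 180), Thm. 9.7 (p. 189)] -/
theorem kpResidueManinUnitFiveSeven_of_kato_of_iharaSq_of_witness (hnf : exists_isNewformOf)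
    (hF : kato_neron_isIntegral_twistedSymbolSum_of_additive_five_le)
    (hI : diamondRibet1997_iharaLemma_sq)
    (hW : ∀ (W : WeierstrassCurve ℚ) [W.IsElliptic] [W.IsGloballyMinimal] (p : ℕ) [Fact p.Prime] (S : ℕ),
      p ≠ 2 → Irr W p → S ≠ 0 →
      ∃ r₀ : ℕ, r₀.Prime ∧ ¬ r₀ ∣ S ∧ r₀ ≡ 1 [MOD S] ∧ ¬ (p : ℤ) ∣ W.LFunction r₀ - (r₀ + 1)) :
    KPResidueManinUnitFiveSeven :=
  KPResidueOfKatoPeriodTwist.kpResidueManinUnitFiveSeven_of_kato_of_periodTwist hnf hF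
    (fun p _ q _ V₀ _ _ _ D₀ hp5 hirr hq2 hqp hqN Vχ _ _ v hv s hs2 N' _ g hg ↦
      lTwist_of_iharaSq_of_witness hI hW p q V₀ D₀ hp5 hirr hq2 hqp hqN Vχ v hv s hs2 N' g hg)

/-! ### §4 (appended) The witness discharged: L-TWIST, TDS57 and KP57 from F″ and the three-copy Ihara lemma ALONE -/

/-- **L-TWIST GRANTED ONLY the three-copy Ihara lemma** (cite-only, Diamond–Ribet 1997 Lemma 4.6): the hypothesis
`hLT` of `TwistDegreeStepFiveSevenKPTors.twistDegreeStepFiveSeven_of_kato_of_periodTwist` VERBATIM, the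
non-Eisenstein witness `hW` of `lTwist_of_iharaSq_of_witness` being the THEOREM `NonEisensteinWitness.lTwistWitness`
(edix-p5: Chebotarev on `ker ρ̄_{E,p} ⊓ Gal(ℚ̄/ℚ(μ_{S}))` + Weil pairing + «all traces `2` ⇒ a common fixed line»,
Darmon–Diamond–Taylor Lemma 4.12 (⟸) as a theorem of the tree). CONDITIONAL on `hI` only; BSD is not proved.
[cite: DiamondRibet1997, §4.5 Lemma 4.6 (p. 371), case m_p = 2] [cite: DarmonDiamondTaylor1995, §4.5 p. 137] -/
theorem lTwist_of_iharaSq (hI : diamondRibet1997_iharaLemma_sq) :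
    ∀ (p : ℕ) [Fact p.Prime] (q : ℕ) [Fact q.Prime] (V₀ : WeierstrassCurve ℚ) [V₀.IsElliptic]
      [V₀.IsGloballyMinimal] [NeZero (V₀.conductorNorm ℤ)]
      (D₀ : ModularParametrizationData V₀ (V₀.conductorNorm ℤ)), 5 ≤ p → Irr V₀ p → q ≠ 2 → q ≠ p →
      ¬ q ∣ V₀.conductorNorm ℤ →
      ∀ (Vχ : WeierstrassCurve ℚ) [Vχ.IsElliptic] [Vχ.IsGloballyMinimal] (v : VariableChange ℚ),
      v • V₀.quadraticTwist (((-1 : ℤ) ^ (q / 2) * q : ℤ) : ℚ) = Vχ →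
      ∀ (s : ℂ), s ^ 2 = (((-1 : ℤ) ^ (q / 2) * q : ℤ) : ℂ) →
      ∀ (N' : ℕ) [NeZero N'] (g : CuspForm (Gamma0 N') 2), IsNewformOf Vχ g →
      ∀ z ∈ periodLattice D₀.f, ∃ w ∈ periodLattice g, ∃ y ∈ periodLattice D₀.f,
        z = s * w + (p : ℂ) * y :=
  lTwist_of_iharaSq_of_witness hI NonEisensteinWitness.lTwistWitness

/-- **TDS57 `TwistDegreeStepFiveSeven` (stmt-BirchSwinnertonDyer-22227) GRANTED the TWO cite-only facts F″ (Kato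
2004 + Kim–Nakamura 2020) and Ihara³ (Diamond–Ribet 1997 Lemma 4.6)** — no other hypothesis: p589348 with L-TWIST
from `lTwist_of_iharaSq`. CONDITIONAL (conditional-result); BSD is not proved by this.
[cite: Kato2004Asterisque, (8.1.3) (p. 180), Thm. 9.7 (p. 189)] [cite: DiamondRibet1997, §4.5 Lemma 4.6 (p. 371)] -/
theorem twistDegreeStepFiveSeven_of_kato_of_iharaSq
    (hF : kato_neron_isIntegral_twistedSymbolSum_of_additive_five_le) (hI : diamondRibet1997_iharaLemma_sq) :
    TwistDegreeStepFiveSeven :=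
  TwistDegreeStepFiveSevenKPTors.twistDegreeStepFiveSeven_of_kato_of_periodTwist hF (lTwist_of_iharaSq hI)

/-- **KP57 `KPResidueManinUnitFiveSeven` (stmt-BirchSwinnertonDyer-23810) GRANTED modularity `exists_isNewformOf`
and the TWO cite-only facts F″ and Ihara³** — no other hypothesis: edix-p5's p590967 with L-TWIST from
`lTwist_of_iharaSq`. CONDITIONAL (conditional-result); BSD is not proved by this.
[cite: Kato2004Asterisque, (8.1.3) (p. 180), Thm. 9.7 (p. 189)] [cite: DiamondRibet1997, §4.5 Lemma 4.6 (p. 371)] -/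
theorem kpResidueManinUnitFiveSeven_of_kato_of_iharaSq (hnf : exists_isNewformOf)
    (hF : kato_neron_isIntegral_twistedSymbolSum_of_additive_five_le) (hI : diamondRibet1997_iharaLemma_sq) :
    KPResidueManinUnitFiveSeven :=
  KPResidueOfKatoPeriodTwist.kpResidueManinUnitFiveSeven_of_kato_of_periodTwist hnf hF (lTwist_of_iharaSq hI)

end Summit.BirchSwinnertonDyer.BirchSwinnertonDyer.Theorems.LTwist

end
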